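import Summits.QuantumFields.QCD.Theses.GapBuysCauchyRate
import Literature.MathematicalPhysics.QuantumFieldTheory.GaugeCovariantBlockMap
import Literature.MathematicalPhysics.QuantumFieldTheory.QCDTorusAxisPermutation
import Literature.MathematicalPhysics.QuantumFieldTheory.QCDObservableAxisPermutation
import Literature.MathematicalPhysics.QuantumFieldTheory.QCDFlavourSymmetry

/-!
# Stub `stub_onePointPseudoDiag` of line `birth` for crux `GapBuysCauchyRate.LadderCauchyRate`
(item stmt-QuantumFields-17307, route route-QuantumFields-GapBuysCauchyRate, sub-problem QCD)

**Parity of the honest lattice-QCD torus functional**: on every odd torus `2S+1`, for every coupling `β`,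
all bare masses and every flavour `f`, the one-point expectation of the flavour-diagonal pseudoscalar density
`⟨pseudoRe f f (0)⟩ = ⟨P_ff(0)⟩` vanishes (`qcdTorusExpect … (insertion · (pseudoRe f f) 0) = 0`).
Proof: the transposition `π = (0 1)` of two axes with its spinor intertwiner
`(S, S') = (γ₅(γ₀ − γ₁), (γ₀ − γ₁)γ₅/2)` (`transpositionSpinor_intertwines_01`) is a symmetry of the honest
functional (`qcdTorusExpect_quarkAxisPerm`, Montvay–Münster 1994 §4.2/App. A); on generators `quarkAxisPerm`
acts by `ψ̄_{f,x,a,·} ↦ ψ̄_{f,πx,a,·} S`, `ψ_{f,x,a,·} ↦ S' ψ_{f,πx,a,·}` (`map_blockSubst_psiBar/psi`,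
`map_funLeft_gen`, `sum_spinBlock_col/row_smul`), so `P_{fg}(x) = ψ̄_f iγ₅ ψ_g (x) ↦ ψ̄_f (S iγ₅ S') ψ_g (πx)`
with `S γ₅ S' = −γ₅` (an odd hypercubic element flips chirality; checked on the explicit chiral-basis
matrices) and `π 0 = 0`; hence `⟨P_ff(0)⟩ = ⟨−P_ff(0)⟩ = −⟨P_ff(0)⟩` (`qcdTorusExpect_smul` of
`QCDFlavourSymmetry`), i.e. `⟨P_ff(0)⟩ = 0`.

Pure theorem file (no definitions): the registered stub signature, proved in tree vocabulary.
-/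

noncomputable section

namespace Summit.QuantumFields.QCD.Cruxes.LadderCauchyRate.Birth

open scoped BigOperators Topology Classical
open MeasureTheory Filter
open Literature.MathematicalPhysics.AQFT Literature.Probability.LatticeModels
  Literature.MathematicalPhysics.QuantumLattice Literature.MathematicalPhysics.QuantumFieldTheory
open Summit.QuantumFields.QCD.Theses.GapBuysCauchyRate

section Helpers

variable {Nf L : ℕ} [NeZero L]

open GrassmannAlgebra in
/-- The axis permutation `(π, S, S')` on a single `ψ̄`: `ψ̄_{f,x,a,α} ↦ Σ_m S_{mα} ψ̄_{f,πx,a,m}`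
(spin block substitution `map_blockSubst_psiBar`, then the site relabelling `map_funLeft_gen`). -/
private theorem quarkAxisPerm_qbar (π : Equiv.Perm (Fin 4)) (S S' : Matrix (Fin 4) (Fin 4) ℂ)
    (f : Fin Nf) (x : TorusSite 4 L) (a : Fin 3) (α : Fin 4) :
    quarkAxisPerm Nf π S S' (qbar (f, (x, a, α))) =
      ∑ m : Fin 4, S m α • qbar (Nf := Nf) (f, (sitePerm π x, a, m)) := by
  have hb : ∀ i, ExteriorAlgebra.map (LinearMap.funLeft ℂ ℂ
      (toLex.symm.trans ((Equiv.sumCongr (quarkSitePerm Nf π) (quarkSitePerm Nf π)).trans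
        (toLex : FermiIdx Nf L ⊕ FermiIdx Nf L ≃ FermiIdx Nf L ⊕ₗ FermiIdx Nf L))).symm) (psiBar ℂ i) =
      psiBar ℂ (quarkSitePerm Nf π i) := fun i => by
    rw [psiBar, map_funLeft_gen]; rfl
  rw [quarkAxisPerm, AlgHom.comp_apply, qbar, map_blockSubst_psiBar, sum_spinBlock_col_smul, map_sum]
  simp only [map_smul, hb, quarkSitePerm_quarkEquiv, qbar]

open GrassmannAlgebra in
/-- The axis permutation `(π, S, S')` on a single `ψ`: `ψ_{f,x,a,β} ↦ Σ_n S'_{βn} ψ_{f,πx,a,n}`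
(spin block substitution `map_blockSubst_psi`, then the site relabelling `map_funLeft_gen`). -/
private theorem quarkAxisPerm_q (π : Equiv.Perm (Fin 4)) (S S' : Matrix (Fin 4) (Fin 4) ℂ)
    (f : Fin Nf) (x : TorusSite 4 L) (a : Fin 3) (β : Fin 4) :
    quarkAxisPerm Nf π S S' (q (f, (x, a, β))) =
      ∑ n : Fin 4, S' β n • q (Nf := Nf) (f, (sitePerm π x, a, n)) := by
  have hp : ∀ i, ExteriorAlgebra.map (LinearMap.funLeft ℂ ℂ
      (toLex.symm.trans ((Equiv.sumCongr (quarkSitePerm Nf π) (quarkSitePerm Nf π)).trans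
        (toLex : FermiIdx Nf L ⊕ FermiIdx Nf L ≃ FermiIdx Nf L ⊕ₗ FermiIdx Nf L))).symm) (psi ℂ i) =
      psi ℂ (quarkSitePerm Nf π i) := fun i => by
    rw [psi, map_funLeft_gen]; rfl
  rw [quarkAxisPerm, AlgHom.comp_apply, q, map_blockSubst_psi]
  simp only [Matrix.transpose_apply]
  rw [sum_spinBlock_row_smul, map_sum]
  simp only [map_smul, hp, quarkSitePerm_quarkEquiv, q]

/-- Reordering a fourfold spin sum: `Σ_α Σ_β Σ_m Σ_n = Σ_m Σ_n Σ_β Σ_α`. -/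
private theorem sum_four_comm {M : Type*} [AddCommMonoid M] (F : Fin 4 → Fin 4 → Fin 4 → Fin 4 → M) :
    ∑ α, ∑ β, ∑ m, ∑ n, F α β m n = ∑ m, ∑ n, ∑ β, ∑ α, F α β m n :=
  calc ∑ α, ∑ β, ∑ m, ∑ n, F α β m n
      = ∑ β, ∑ α, ∑ m, ∑ n, F α β m n := Finset.sum_comm
    _ = ∑ β, ∑ m, ∑ α, ∑ n, F α β m n := Finset.sum_congr rfl fun _ _ => Finset.sum_comm
    _ = ∑ β, ∑ m, ∑ n, ∑ α, F α β m n :=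
        Finset.sum_congr rfl fun _ _ => Finset.sum_congr rfl fun _ _ => Finset.sum_comm
    _ = ∑ m, ∑ β, ∑ n, ∑ α, F α β m n := Finset.sum_comm
    _ = ∑ m, ∑ n, ∑ β, ∑ α, F α β m n := Finset.sum_congr rfl fun _ _ => Finset.sum_comm

/-- **The axis permutation on the local pseudoscalar bilinear**: the spin matrix `iγ₅` is conjugated,
`(π,S,S')·P_{fg}(x) = Σ_a ψ̄_{f,πx,a,·} (S · iγ₅ · S') ψ_{g,πx,a,·}`. -/
private theorem quarkAxisPerm_pseudoscalarBilinear (π : Equiv.Perm (Fin 4))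
    (S S' : Matrix (Fin 4) (Fin 4) ℂ) (f g : Fin Nf) (x : TorusSite 4 L) :
    quarkAxisPerm Nf π S S' (pseudoscalarBilinear f g x) =
      ∑ a : Fin 3, ∑ m : Fin 4, ∑ n : Fin 4,
        (S * (Complex.I • gammaFive) * S') m n •
          (qbar (Nf := Nf) (f, (sitePerm π x, a, m)) * q (g, (sitePerm π x, a, n))) := by
  simp only [pseudoscalarBilinear, map_sum, map_smul, map_mul, quarkAxisPerm_qbar, quarkAxisPerm_q,
    Finset.sum_mul_sum, smul_mul_smul_comm, Finset.smul_sum, smul_smul]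
  refine Finset.sum_congr rfl fun a _ => ?_
  rw [sum_four_comm]
  refine Finset.sum_congr rfl fun m _ => Finset.sum_congr rfl fun n _ => ?_
  simp only [Matrix.mul_apply, Matrix.smul_apply, smul_eq_mul, Finset.sum_mul, Finset.sum_smul]
  refine Finset.sum_congr rfl fun β _ => Finset.sum_congr rfl fun α _ => ?_
  congr 1
  ring

/-- `γ₅(γ₀ − γ₁) · γ₅ · (γ₀ − γ₁)γ₅/2 = −γ₅`: the spinor matrix of the transposition `(0 1)` (an ODD
element of the hypercubic group) anticommutes with `γ₅` (checked on the explicit chiral-basis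
matrices). -/
private theorem transpositionSpinor_gammaFive_transpositionSpinorInv :
    transpositionSpinor 0 1 * gammaFive * transpositionSpinorInv 0 1 = -gammaFive := by
  simp only [transpositionSpinor, transpositionSpinorInv, gammaFive_eq_explicit, euclideanGamma_zero,
    euclideanGamma_one]
  norm_num [Complex.ext_iff]

/-- **The pseudoscalar density is odd under the transposition of two axes**:
`(π,S,S')·P_{fg}(x) = −P_{fg}(πx)` for `π = (0 1)`, `S = γ₅(γ₀ − γ₁)`, `S' = (γ₀ − γ₁)γ₅/2`. -/
private theorem quarkAxisPerm_swap_pseudoscalarBilinear (f g : Fin Nf) (x : TorusSite 4 L) :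
    quarkAxisPerm Nf (Equiv.swap 0 1) (transpositionSpinor 0 1) (transpositionSpinorInv 0 1)
        (pseudoscalarBilinear f g x) =
      -pseudoscalarBilinear f g (sitePerm (Equiv.swap 0 1) x) := by
  rw [quarkAxisPerm_pseudoscalarBilinear, Matrix.mul_smul, Matrix.smul_mul,
    transpositionSpinor_gammaFive_transpositionSpinorInv, smul_neg, pseudoscalarBilinear]
  simp only [Matrix.neg_apply, Matrix.smul_apply, smul_eq_mul, neg_smul, Finset.sum_neg_distrib]

end Helpers

/-- (A) **parity: the flavour-diagonal pseudoscalar one-point expectation vanishes** (size M,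
provable now: the transposition of two axes is a symmetry of the honest functional,
`qcdTorusExpect_quarkAxisPerm` with `transpositionSpinor`, and conjugates `iγ₅` to `−iγ₅`). -/
theorem stub_onePointPseudoDiag :
    ∀ (Nf S : ℕ) (β : ℝ) (mq : Fin Nf → ℝ) (f : Fin Nf),
      qcdTorusExpect β (2 * S + 1) mq (fun U => insertion U (QCDField.pseudoRe f f) 0) = 0 := by
  intro Nf S β mq f
  -- the origin is fixed by the axis permutation
  have hx : sitePerm (Equiv.swap (0 : Fin 4) 1) (Torus.proj (2 * S + 1) (0 : Fin 4 → ℤ)) =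
      Torus.proj (2 * S + 1) (0 : Fin 4 → ℤ) := by
    funext j
    simp only [sitePerm_apply, Torus.proj_apply, Pi.zero_apply]
  -- the insertion `pseudoRe f f` at the origin, unfolded (it does not read the gauge field)
  have hins : ∀ U : GaugeConfig 4 (2 * S + 1) (Matrix.specialUnitaryGroup (Fin 3) ℂ),
      insertion U (QCDField.pseudoRe f f) (0 : Fin 4 → ℤ) =
        (1 / 2 : ℂ) • (pseudoscalarBilinear (Nf := Nf) f f (Torus.proj (2 * S + 1) (0 : Fin 4 → ℤ)) +
          pseudoscalarBilinear f f (Torus.proj (2 * S + 1) (0 : Fin 4 → ℤ))) := fun U => rfl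
  -- the permuted insertion is MINUS the insertion
  have hperm : ∀ U : GaugeConfig 4 (2 * S + 1) (Matrix.specialUnitaryGroup (Fin 3) ℂ),
      quarkAxisPerm Nf (Equiv.swap 0 1) (transpositionSpinor 0 1) (transpositionSpinorInv 0 1)
          (insertion (configPerm (Equiv.swap (0 : Fin 4) 1).symm U) (QCDField.pseudoRe f f) 0) =
        (-1 : ℂ) • insertion U (QCDField.pseudoRe f f) 0 := by
    intro U
    rw [hins, hins, map_smul, map_add, quarkAxisPerm_swap_pseudoscalarBilinear, hx, ← neg_add, smul_neg,
      neg_one_smul]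
  -- covariance of the honest functional under `(0 1)`: `⟨−P_ff(0)⟩ = ⟨P_ff(0)⟩`, i.e. `−E = E`
  have h := qcdTorusExpect_quarkAxisPerm (L := 2 * S + 1) transpositionSpinor_intertwines_01 β mq
    (fun U => insertion U (QCDField.pseudoRe f f) 0)
  simp only [hperm, qcdTorusExpect_smul] at h
  linear_combination (-1 / 2 : ℂ) * h

end Summit.QuantumFields.QCD.Cruxes.LadderCauchyRate.Birth

end
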